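import Summits.ABC.ABC.Theses.DefiniteXi
import Summits.ABC.ABC.Theorems.DefiniteXiPolyDegreeToPolyABC
import Summits.ABC.ABC.Theorems.DefiniteXiPolyFreyDegree
import Literature.Barriers.ABC.BakerMethodBounds
import Literature.NumberTheory.DiophantineGeometry.AbcWave0QualityFormProofs
import HarnessLib

/-!
# Route DefiniteXi — item `PolyFreyDegree` (stmt-ABC-2026): the weak rung IS polynomial abc

Item `Summit.ABC.ABC.Theses.DefiniteXi.PolyFreyDegree` (support, rank 9): absolute `A, C` with,
for all coprime `a, b` (`ab(a+b) ≠ 0`) and `N` the conductor of the Frey curve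
`E_{a,b} : y² = x(x − a)(x + b)`, SOME modular parametrisation datum of `E_{a,b}` at level `N`
of degree `≤ C · N^A`.

This file pins the item to the barrier catalogue's vocabulary.  `Literature.Barriers.ABC.BakerShapeBound θ m`
is the shape `log c ≤ κ · rad(abc)^θ · (log rad(abc))^m` of every bound for `c` in terms of the
radical; `(θ, m) = (1/3, 3)` is Stewart–Yu 2001 (= `BakerMethodBounds`, the best known), and
`(θ, m) = (0, 1)` — `log c ≤ κ log rad(abc)`, i.e. `c ≤ rad(abc)^κ` — is **polynomial abc**
("θ = 0 ∧ m = 1 means polynomially", docstring of `BakerShapeBound`), far beyond the Baker-method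
class and open.

* (F1) `bakerShapeBound_zero_one_of_polyFreyDegree` — **`PolyFreyDegree → BakerShapeBound 0 1`,
  UNCONDITIONALLY**: the landed `polyDegreeToPolyABC_proof` (stmt-ABC-2027: Zagier's identity, the
  proved Hoffstein–Lockhart range `(f,f) ≫ N^{1/4}`, Silverman's proved covolume inequality) gives
  `c ≤ C rad(abc)^κ`, and `rad(abc) ≥ 2` on abc triples absorbs the constant into the exponent
  (`bakerShapeBound_zero_one_of_polyAbc`).
* (F2) `modularDegree_le_maninSq_rpow_of_bakerShapeBound_of_petersson` — the polynomial twin of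
  Murty 1999, Thm. 1 (ii) (tree: `modularDegree_le_maninSq_rpow_of_abcLe_of_petersson`), for EVERY
  datum and with the Manin constant explicit: a POLYNOMIAL Petersson upper bound
  `(f,f) ≤ C₂ N^B` for newforms of elliptic curves (any exponent `B`; in print `(f,f) ≪ N log N`,
  Rankin–Selberg) and `BakerShapeBound 0 1` give `deg φ_D ≤ K · c_D² · N^A` for every datum `D` of
  every Frey curve.  No modularity and no Manin bound is used (Zagier + Silverman's lower covolume
  inequality on the Frey model + `rad(ab(a+b)) ∣ 2N`, all theorems of the tree).
* (F3) `polyFreyDegree_of_bakerShapeBound_of_petersson_of_manin` — hence `BakerShapeBound 0 1 →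
  PolyFreyDegree` given the polynomial Petersson upper bound and Frey data with POLYNOMIALLY
  bounded Manin constant (`|c_D| ≤ M N^{B'}` for some datum; this existence hypothesis contains
  `FreyModularity` and is true in print with `B' = 0`: BCDT + Pasten 2024 Thm. 1.3 + Mazur–Kenku);
  `…_of_manin'` is the same with the tree's hypothesis shapes `(f,f) ≤ C₂ N^{1+θ}`, `|c_D| ≤ M`.
* (F4) `polyFreyDegree_iff_bakerShapeBound_zero_one_of` — **modulo those two true-in-print inputs
  the item is LITERALLY `BakerShapeBound 0 1`** (polynomial abc), the `∃ κ`-shadow of Murty's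
  `abcLe_iff_freyDegreeConjecture` one rung down.  So an unconditional proof of the item is a
  polynomial abc inequality (nothing of the kind is known: `BakerMethodBounds` is `(1/3, 3)`), and
  an unconditional refutation is `¬` polynomial abc (or `¬` modularity).

Together with the landed `polyFreyDegree_iff_freyModularity_and_minimalBound` and
`polyFreyDegree_of_xiBound` (file `DefiniteXiPolyFreyDegree.lean`) this places the item exactly:
`XiBound ∧ known facts ⟹ PolyFreyDegree ⟺ (polynomial abc, given Murty's inputs)`.

## References

* M. R. Murty, *Bounds for congruence primes*, Proc. Sympos. Pure Math. 66.1 (1999), Thm. 1, §2.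
* G. Frey, *On ternary equations of Fermat type and relations with elliptic curves* (1997), Cor. 3.1.
* H. Pasten, *Shimura curves and the abc conjecture*, J. Number Theory 254 (2024), §3, Thm. 1.3.
* C. L. Stewart, K. Yu, Duke Math. J. 108 (2001), Thm. 1 (the `(1/3, 3)` shape).
* J.-H. Evertse, K. Győry, *Unit equations in Diophantine number theory* (2015), §4.6.
-/

-- `Summit.<Summit>.<Problem>` is the mandated namespace; for the single-conjunct summit ABC the duplicate ABC.ABC is deliberate.
set_option linter.dupNamespace false

noncomputable section

namespace Summit.ABC.ABC.Theorems.DefiniteXiPolyFreyDegree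

open IsDedekindDomain WeierstrassCurve UniqueFactorizationMonoid CongruenceSubgroup
open Literature.NumberTheory
open Literature.NumberTheory.EllipticCurves
open Literature.NumberTheory.EllipticCurves.ModularForms
open Literature.NumberTheory.DiophantineGeometry
open Literature.Barriers.ABC
open Summit.ABC.ABC.Theses.DefiniteXi

/-! ## (F1) `PolyFreyDegree → BakerShapeBound 0 1` -/

/-- A polynomial abc inequality `c ≤ C · rad(abc)^κ` is the Baker shape `(0, 1)`:
`log c ≤ κ' · log rad(abc)` with `κ' = log (max C 1) / log 2 + max κ 0`, because `rad(abc) ≥ 2`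
on abc triples (`IsABCTriple.two_le_rad`). [folklore] -/
theorem bakerShapeBound_zero_one_of_polyAbc
    (h : ∃ κ C : ℝ, ∀ a b c : ℕ, IsABCTriple a b c → (c : ℝ) ≤ C * ((rad a b c : ℕ) : ℝ) ^ κ) :
    BakerShapeBound 0 1 := by
  obtain ⟨κ, C, hC⟩ := h
  refine ⟨Real.log (max C 1) / Real.log 2 + max κ 0, fun a b c ht ↦ ?_⟩
  have hR2 : (2 : ℝ) ≤ ((rad a b c : ℕ) : ℝ) := by exact_mod_cast ht.two_le_rad
  have hR1 : (1 : ℝ) ≤ ((rad a b c : ℕ) : ℝ) := by linarith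
  have hR0 : (0 : ℝ) < ((rad a b c : ℕ) : ℝ) := by linarith
  have hc0 : (0 : ℝ) < (c : ℝ) := by exact_mod_cast lt_of_lt_of_le (by norm_num) ht.two_le
  have hlog2 : 0 < Real.log 2 := Real.log_pos (by norm_num)
  have hlogR : Real.log 2 ≤ Real.log ((rad a b c : ℕ) : ℝ) := Real.log_le_log (by norm_num) hR2
  have hC1 : (1 : ℝ) ≤ max C 1 := le_max_right _ _
  have hC0 : (0 : ℝ) < max C 1 := zero_lt_one.trans_le hC1
  -- `c ≤ max C 1 · rad^{max κ 0}`
  have hle : (c : ℝ) ≤ max C 1 * ((rad a b c : ℕ) : ℝ) ^ (max κ 0) :=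
    calc (c : ℝ) ≤ C * ((rad a b c : ℕ) : ℝ) ^ κ := hC a b c ht
      _ ≤ max C 1 * ((rad a b c : ℕ) : ℝ) ^ κ :=
          mul_le_mul_of_nonneg_right (le_max_left _ _) (Real.rpow_nonneg hR0.le _)
      _ ≤ max C 1 * ((rad a b c : ℕ) : ℝ) ^ (max κ 0) :=
          mul_le_mul_of_nonneg_left (Real.rpow_le_rpow_of_exponent_le hR1 (le_max_left _ _))
            hC0.le
  have hlogc : Real.log c ≤ Real.log (max C 1) + max κ 0 * Real.log ((rad a b c : ℕ) : ℝ) := by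
    have h1 := Real.log_le_log hc0 hle
    rwa [Real.log_mul hC0.ne' (Real.rpow_pos_of_pos hR0 _).ne', Real.log_rpow hR0] at h1
  -- `log (max C 1) ≤ (log (max C 1) / log 2) · log rad`
  have hconst : Real.log (max C 1) ≤
      Real.log (max C 1) / Real.log 2 * Real.log ((rad a b c : ℕ) : ℝ) := by
    have h0 : 0 ≤ Real.log (max C 1) := Real.log_nonneg hC1
    calc Real.log (max C 1) = Real.log (max C 1) / Real.log 2 * Real.log 2 := by
          field_simp
      _ ≤ Real.log (max C 1) / Real.log 2 * Real.log ((rad a b c : ℕ) : ℝ) :=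
          mul_le_mul_of_nonneg_left hlogR (div_nonneg h0 hlog2.le)
  rw [Real.rpow_zero, mul_one, pow_one]
  calc Real.log c ≤ Real.log (max C 1) + max κ 0 * Real.log ((rad a b c : ℕ) : ℝ) := hlogc
    _ ≤ Real.log (max C 1) / Real.log 2 * Real.log ((rad a b c : ℕ) : ℝ) +
          max κ 0 * Real.log ((rad a b c : ℕ) : ℝ) := by linarith
    _ = (Real.log (max C 1) / Real.log 2 + max κ 0) * Real.log ((rad a b c : ℕ) : ℝ) := by ring

/-- **(F1) `PolyFreyDegree → BakerShapeBound 0 1`, unconditionally.** The weak rung of the route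
gives polynomial abc in the barrier catalogue's shape `(θ, m) = (0, 1)`: the landed
`polyDegreeToPolyABC_proof` (stmt-ABC-2027; Frey 1997 Cor. 3.1 / Murty 1999 §2 with exponents
carried) composed with `bakerShapeBound_zero_one_of_polyAbc`. [folklore] -/
theorem bakerShapeBound_zero_one_of_polyFreyDegree (h : PolyFreyDegree) : BakerShapeBound 0 1 :=
  bakerShapeBound_zero_one_of_polyAbc (polyDegreeToPolyABC_proof h)

/-! ## (F2) Polynomial abc for signed triples, and the degree of every datum -/

/-- `BakerShapeBound 0 1` in multiplicative form: `c ≤ rad(abc)^κ` with `κ ≥ 0` for every abc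
triple (`c = exp(log c) ≤ exp(κ log rad) = rad^κ`). [folklore] -/
theorem polyAbc_of_bakerShapeBound_zero_one (h : BakerShapeBound 0 1) :
    ∃ κ : ℝ, 0 ≤ κ ∧ ∀ a b c : ℕ, IsABCTriple a b c → (c : ℝ) ≤ ((rad a b c : ℕ) : ℝ) ^ κ := by
  obtain ⟨κ₀, hκ₀⟩ := h
  refine ⟨max κ₀ 0, le_max_right _ _, fun a b c ht ↦ ?_⟩
  have h := hκ₀ a b c ht
  rw [Real.rpow_zero, mul_one, pow_one] at h
  have hR2 : (2 : ℝ) ≤ ((rad a b c : ℕ) : ℝ) := by exact_mod_cast ht.two_le_rad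
  have hR0 : (0 : ℝ) < ((rad a b c : ℕ) : ℝ) := by linarith
  have hc0 : (0 : ℝ) < (c : ℝ) := by exact_mod_cast lt_of_lt_of_le (by norm_num) ht.two_le
  have hlogR0 : 0 ≤ Real.log ((rad a b c : ℕ) : ℝ) := Real.log_nonneg (by linarith)
  have h' : Real.log c ≤ max κ₀ 0 * Real.log ((rad a b c : ℕ) : ℝ) :=
    h.trans (mul_le_mul_of_nonneg_right (le_max_left _ _) hlogR0)
  calc (c : ℝ) = Real.exp (Real.log c) := (Real.exp_log hc0).symm
    _ ≤ Real.exp (max κ₀ 0 * Real.log ((rad a b c : ℕ) : ℝ)) := Real.exp_le_exp.mpr h'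
    _ = ((rad a b c : ℕ) : ℝ) ^ (max κ₀ 0) := by
        rw [Real.rpow_def_of_pos hR0]
        congr 1
        ring

/-- **Polynomial abc for signed triples.** From `BakerShapeBound 0 1`: there is `κ ≥ 0` such that
for nonzero integers `A + B + D = 0` with `A, B` coprime, `|A|, |B|, |D| ≤ rad(|ABD|)^κ` (rearrange
signs so that the two summands of equal sign are the `a, b` of an abc triple; same bookkeeping as
`DiophantineGeometry.abc_int_of_abcLe`). [folklore] -/
theorem abc_int_of_bakerShapeBound_zero_one (h : BakerShapeBound 0 1) :
    ∃ κ : ℝ, 0 ≤ κ ∧ ∀ A B D : ℤ, A ≠ 0 → B ≠ 0 → D ≠ 0 → IsCoprime A B → A + B + D = 0 →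
      (A.natAbs : ℝ) ≤ ((radical (A * B * D).natAbs : ℕ) : ℝ) ^ κ ∧
      (B.natAbs : ℝ) ≤ ((radical (A * B * D).natAbs : ℕ) : ℝ) ^ κ ∧
      (D.natAbs : ℝ) ≤ ((radical (A * B * D).natAbs : ℕ) : ℝ) ^ κ := by
  obtain ⟨κ, hκ0, hκ⟩ := polyAbc_of_bakerShapeBound_zero_one h
  refine ⟨κ, hκ0, fun A B D hA hB hD hAB hsum ↦ ?_⟩
  -- the three arrangements of signs
  set a := A.natAbs with ha
  set b := B.natAbs with hb
  set d := D.natAbs with hd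
  have ha0 : 0 < a := Int.natAbs_pos.mpr hA
  have hb0 : 0 < b := Int.natAbs_pos.mpr hB
  have hd0 : 0 < d := Int.natAbs_pos.mpr hD
  have hrad : (A * B * D).natAbs = a * b * d := by simp [ha, hb, hd, Int.natAbs_mul]
  rw [hrad]
  -- pairwise coprimality
  have hAD : IsCoprime A D := by
    have : D = -(B + A * 1) := by linear_combination hsum
    rw [this]
    exact (hAB.add_mul_left_right 1).neg_right
  have hBD : IsCoprime B D := by
    have : D = -(A + B * 1) := by linear_combination hsum
    rw [this]
    exact (hAB.symm.add_mul_left_right 1).neg_right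
  have cop : ∀ {M N : ℤ}, IsCoprime M N → Nat.Coprime M.natAbs N.natAbs := by
    intro M N h
    rw [Nat.Coprime, ← Int.gcd_eq_natAbs]
    exact Int.isCoprime_iff_gcd_eq_one.mp h
  -- the bound for an abc triple `(m, n, m + n)` bounds all three entries
  have key : ∀ m n k : ℕ, 0 < m → 0 < n → m + n = k → Nat.Coprime m n →
      (m : ℝ) ≤ ((radical (m * n * k) : ℕ) : ℝ) ^ κ ∧
      (n : ℝ) ≤ ((radical (m * n * k) : ℕ) : ℝ) ^ κ ∧
      (k : ℝ) ≤ ((radical (m * n * k) : ℕ) : ℝ) ^ κ := by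
    intro m n k hm hn hk hmn
    have h := hκ m n k ⟨hm, hn, hk, hmn⟩
    rw [rad_def] at h
    have hmk : (m : ℝ) ≤ k := by exact_mod_cast (show m ≤ k by omega)
    have hnk : (n : ℝ) ≤ k := by exact_mod_cast (show n ≤ k by omega)
    exact ⟨hmk.trans h, hnk.trans h, h⟩
  have hcases : a + b = d ∨ a + d = b ∨ b + d = a := by omega
  rcases hcases with h | h | h
  · exact key a b d ha0 hb0 h (cop hAB)
  · obtain ⟨h1, h2, h3⟩ := key a d b ha0 hd0 h (cop hAD)
    rw [show a * d * b = a * b * d by ring] at h1 h2 h3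
    exact ⟨h1, h3, h2⟩
  · obtain ⟨h1, h2, h3⟩ := key b d a hb0 hd0 h (cop hBD)
    rw [show b * d * a = a * b * d by ring] at h1 h2 h3
    exact ⟨h3, h1, h2⟩

/-- **(F2) Polynomial Murty (ii) for every datum, Manin constant explicit.** Suppose
`(f,f) ≤ C₂ N^B` for the newform of every elliptic curve over `ℚ` (un-normalised Petersson norm on
`Γ₀(N)`; a hypothesis, in print `(f,f) ≪ N log N` by Rankin–Selberg) and `BakerShapeBound 0 1`
(polynomial abc). Then there are `A, K ≥ 0` with `deg φ_D ≤ K · c_D² · N^A` for all coprime `a, b`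
with `ab(a+b) ≠ 0` and EVERY modular parametrisation datum `D` (Manin constant `c_D`) of the Frey
curve `E_{a,b}` at the level `N` of its conductor. Murty 1999, §2 with polynomial losses:
`deg φ = 4π² c² (f,f) / covol(Λ)` (Zagier, proved), `covol(Λ)⁻¹ ≪ max(|c₄|³,|c₆|²)^{1/6} ≪
max(|a|,|b|)` (Silverman, proved), `max(|a|,|b|) ≤ rad(ab(a+b))^κ` (polynomial abc),
`rad(ab(a+b)) ≤ 2N` (proved); `A = max B 0 + κ`. No modularity, no Manin bound.
[cite: MurtyCongruencePrimes1999, Thm. 1 (ii) and §2] -/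
theorem modularDegree_le_maninSq_rpow_of_bakerShapeBound_of_petersson
    (hUp : ∃ B C₂ : ℝ, ∀ (N : ℕ) [NeZero N] (W : WeierstrassCurve ℚ) [W.IsElliptic]
      (f : CuspForm (Gamma0 N) 2), IsNewformOf W f →
        (peterssonProduct (Gamma0 N) 2 f f).re ≤ C₂ * (N : ℝ) ^ B)
    (hBS : BakerShapeBound 0 1) :
    ∃ A K : ℝ, 0 ≤ A ∧ 0 ≤ K ∧ ∀ a b : ℤ, IsCoprime a b → a * b * (a + b) ≠ 0 →
      ∀ (N : ℕ) [NeZero N], (freyCurve a b).conductorNorm ℤ = N →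
        ∀ D : ModularParametrizationData (freyCurve a b) N,
          (D.deg : ℝ) ≤ K * (D.maninConstant : ℝ) ^ 2 * (N : ℝ) ^ A := by
  obtain ⟨B, C₂, hC₂⟩ := hUp
  obtain ⟨κ, hκ0, hκ⟩ := abc_int_of_bakerShapeBound_zero_one hBS
  obtain ⟨A₀, hA₀, hSil⟩ := covolume_rpow_neg_six_le_of_isNeronLatticeOf
  -- the constant, depending on the data of the two hypotheses only
  set K : ℝ := 4 * Real.pi ^ 2 * max C₂ 0 * ((331776 * A₀) ^ (1 / 6 : ℝ) * (2 : ℝ) ^ κ) with hK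
  have hK0 : 0 ≤ K := by positivity
  refine ⟨max B 0 + κ, K, add_nonneg (le_max_right _ _) hκ0, hK0, fun a b hab h0 N _ hN D ↦ ?_⟩
  haveI := isElliptic_freyCurve h0
  have hNpos : (0 : ℝ) < N := by exact_mod_cast Nat.pos_of_ne_zero (NeZero.ne N)
  have hN1 : (1 : ℝ) ≤ N := by exact_mod_cast Nat.one_le_iff_ne_zero.mpr (NeZero.ne N)
  -- Zagier's identity `4π² c² (f,f) = deg · covol`
  have hZ := congrArg Complex.re D.zagier_degree_formula_holds
  rw [Complex.re_ofReal_mul, Complex.ofReal_re] at hZ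
  have hP0 : 0 ≤ (peterssonProduct (Gamma0 N) 2 D.f D.f).re :=
    D.zagier_degree_formula_holds.peterssonProduct_re_pos.le
  have hcov : 0 < ZLattice.covolume D.L.lattice := ZLattice.covolume_pos _ _
  -- the Petersson upper bound, exponent clamped at `max B 0`
  have hP : (peterssonProduct (Gamma0 N) 2 D.f D.f).re ≤ max C₂ 0 * (N : ℝ) ^ (max B 0) :=
    calc (peterssonProduct (Gamma0 N) 2 D.f D.f).re ≤ C₂ * (N : ℝ) ^ B :=
          hC₂ N (freyCurve a b) D.f D.isNewformOf
      _ ≤ max C₂ 0 * (N : ℝ) ^ B :=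
          mul_le_mul_of_nonneg_right (le_max_left _ _) (Real.rpow_nonneg hNpos.le _)
      _ ≤ max C₂ 0 * (N : ℝ) ^ (max B 0) :=
          mul_le_mul_of_nonneg_left (Real.rpow_le_rpow_of_exponent_le hN1 (le_max_left _ _))
            (le_max_right _ _)
  -- polynomial abc for the triple `a + b + (−(a+b)) = 0`
  have ha0 : a ≠ 0 := fun h ↦ h0 (by simp [h])
  have hb0 : b ≠ 0 := fun h ↦ h0 (by simp [h])
  have hab0 : a + b ≠ 0 := fun h ↦ h0 (by simp [h])
  obtain ⟨haR, hbR, -⟩ := hκ a b (-(a + b)) ha0 hb0 (neg_ne_zero.mpr hab0) hab (by ring)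
  have hnat : (a * b * -(a + b)).natAbs = (a * b * (a + b)).natAbs := by
    rw [show a * b * -(a + b) = -(a * b * (a + b)) by ring, Int.natAbs_neg]
  rw [hnat, Nat.cast_natAbs, Int.cast_abs] at haR hbR
  set R' : ℝ := ((radical (a * b * (a + b)).natAbs : ℕ) : ℝ) ^ κ with hR'
  have hR'0 : 0 ≤ R' := (abs_nonneg _).trans haR
  -- Silverman on the Frey model: `covol⁻¹ ≤ (331776 A₀)^{1/6} R'`
  have h6 : ZLattice.covolume D.L.lattice ^ (-(6 : ℝ)) ≤ (331776 * A₀) * R' ^ 6 := by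
    calc ZLattice.covolume D.L.lattice ^ (-(6 : ℝ))
        ≤ A₀ * ((max (|(freyCurve a b).c₄| ^ 3) (|(freyCurve a b).c₆| ^ 2) : ℚ) : ℝ) :=
          hSil (freyCurve a b) D.L D.isNeronLattice
      _ ≤ A₀ * (331776 * R' ^ 6) :=
          mul_le_mul_of_nonneg_left (max_c₄_c₆_freyCurve_le haR hbR) hA₀.le
      _ = 331776 * A₀ * R' ^ 6 := by ring
  have hinv := inv_le_of_rpow_neg_six_le hcov (by positivity) hR'0 h6
  -- the degree bound with `R'`, Manin constant kept (`|c| ≤ |c|`)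
  have hdeg := deg_le_of_zagier_of_upper hcov hZ le_rfl hP0 hP hinv
  -- `rad(ab(a+b)) ≤ 2N`, so `R' ≤ 2^κ N^κ`
  have hrN : ((radical (a * b * (a + b)).natAbs : ℕ) : ℝ) ≤ 2 * N := by
    have hdvd := radical_natAbs_dvd_two_mul_conductorNorm_freyCurve hab h0
    rw [hN] at hdvd
    exact_mod_cast Nat.le_of_dvd (Nat.pos_of_ne_zero (mul_ne_zero two_ne_zero (NeZero.ne N))) hdvd
  have hR'le : R' ≤ (2 : ℝ) ^ κ * (N : ℝ) ^ κ := by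
    rw [hR', ← Real.mul_rpow (by norm_num) hNpos.le]
    exact Real.rpow_le_rpow (by positivity) hrN hκ0
  have hexp : (N : ℝ) ^ (max B 0) * (N : ℝ) ^ κ = (N : ℝ) ^ (max B 0 + κ) := by
    rw [← Real.rpow_add hNpos]
  have hsq : |(D.c : ℝ)| ^ 2 = (D.maninConstant : ℝ) ^ 2 := sq_abs _
  -- assemble
  calc (D.deg : ℝ)
      ≤ 4 * Real.pi ^ 2 * |(D.c : ℝ)| ^ 2 * (max C₂ 0 * (N : ℝ) ^ (max B 0)) *
          ((331776 * A₀) ^ (1 / 6 : ℝ) * R') := hdeg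
    _ ≤ 4 * Real.pi ^ 2 * |(D.c : ℝ)| ^ 2 * (max C₂ 0 * (N : ℝ) ^ (max B 0)) *
          ((331776 * A₀) ^ (1 / 6 : ℝ) * ((2 : ℝ) ^ κ * (N : ℝ) ^ κ)) := by gcongr
    _ = K * |(D.c : ℝ)| ^ 2 * ((N : ℝ) ^ (max B 0) * (N : ℝ) ^ κ) := by rw [hK]; ring
    _ = K * (D.maninConstant : ℝ) ^ 2 * (N : ℝ) ^ (max B 0 + κ) := by rw [hexp, hsq]

/-! ## (F3) `BakerShapeBound 0 1 → PolyFreyDegree`, given Murty's two inputs -/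

/-- **(F3) Polynomial abc ⟹ the weak rung, relative to a polynomial Petersson upper bound and Frey
data with polynomially bounded Manin constant.** If `(f,f) ≤ C₂ N^B` for newforms of elliptic
curves over `ℚ`, and every Frey curve `E_{a,b}` carries at the level of its conductor SOME modular
parametrisation datum with `|c_D| ≤ M · N^{B'}` (this contains modularity of the Frey curves,
`FreyModularity`; true in print with `B' = 0`: BCDT 2001 + Pasten 2024 Thm. 1.3 + Mazur–Kenku),
then `BakerShapeBound 0 1 → PolyFreyDegree`, with exponent `2 max(B',0) + A` from (F2).
[cite: MurtyCongruencePrimes1999, Thm. 1 (ii) and §2] -/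
theorem polyFreyDegree_of_bakerShapeBound_of_petersson_of_manin
    (hUp : ∃ B C₂ : ℝ, ∀ (N : ℕ) [NeZero N] (W : WeierstrassCurve ℚ) [W.IsElliptic]
      (f : CuspForm (Gamma0 N) 2), IsNewformOf W f →
        (peterssonProduct (Gamma0 N) 2 f f).re ≤ C₂ * (N : ℝ) ^ B)
    (hM : ∃ B' M : ℝ, ∀ a b : ℤ, IsCoprime a b → a * b * (a + b) ≠ 0 →
      ∀ (N : ℕ) [NeZero N], (freyCurve a b).conductorNorm ℤ = N →
        ∃ D : ModularParametrizationData (freyCurve a b) N,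
          (D.maninConstant.natAbs : ℝ) ≤ M * (N : ℝ) ^ B')
    (hBS : BakerShapeBound 0 1) : PolyFreyDegree := by
  obtain ⟨A, K, hA, hK, hdeg⟩ :=
    modularDegree_le_maninSq_rpow_of_bakerShapeBound_of_petersson hUp hBS
  obtain ⟨B', M, hMc⟩ := hM
  unfold PolyFreyDegree
  refine ⟨2 * max B' 0 + A, K * max M 0 ^ 2, fun a b hab h0 N _ hN ↦ ?_⟩
  obtain ⟨D, hDc⟩ := hMc a b hab h0 N hN
  refine ⟨D, ?_⟩
  have hNpos : (0 : ℝ) < N := by exact_mod_cast Nat.pos_of_ne_zero (NeZero.ne N)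
  have hN1 : (1 : ℝ) ≤ N := by exact_mod_cast Nat.one_le_iff_ne_zero.mpr (NeZero.ne N)
  -- `|c_D| ≤ max M 0 · N^{max B' 0}`
  have hc : |(D.maninConstant : ℝ)| ≤ max M 0 * (N : ℝ) ^ (max B' 0) := by
    have h1 : |(D.maninConstant : ℝ)| = (D.maninConstant.natAbs : ℝ) := by
      rw [Nat.cast_natAbs, Int.cast_abs]
    rw [h1]
    calc (D.maninConstant.natAbs : ℝ) ≤ M * (N : ℝ) ^ B' := hDc
      _ ≤ max M 0 * (N : ℝ) ^ B' :=
          mul_le_mul_of_nonneg_right (le_max_left _ _) (Real.rpow_nonneg hNpos.le _)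
      _ ≤ max M 0 * (N : ℝ) ^ (max B' 0) :=
          mul_le_mul_of_nonneg_left (Real.rpow_le_rpow_of_exponent_le hN1 (le_max_left _ _))
            (le_max_right _ _)
  have hc2 : (D.maninConstant : ℝ) ^ 2 ≤ (max M 0 * (N : ℝ) ^ (max B' 0)) ^ 2 := by
    rw [← sq_abs (D.maninConstant : ℝ)]
    exact pow_le_pow_left₀ (abs_nonneg _) hc 2
  have hexp : ((N : ℝ) ^ (max B' 0)) ^ 2 * (N : ℝ) ^ A = (N : ℝ) ^ (2 * max B' 0 + A) := by
    rw [← Real.rpow_natCast, ← Real.rpow_mul hNpos.le, ← Real.rpow_add hNpos]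
    congr 1
    push_cast
    ring
  calc (D.deg : ℝ) ≤ K * (D.maninConstant : ℝ) ^ 2 * (N : ℝ) ^ A := hdeg a b hab h0 N hN D
    _ ≤ K * (max M 0 * (N : ℝ) ^ (max B' 0)) ^ 2 * (N : ℝ) ^ A :=
        mul_le_mul_of_nonneg_right (mul_le_mul_of_nonneg_left hc2 hK) (Real.rpow_nonneg hNpos.le _)
    _ = K * max M 0 ^ 2 * (((N : ℝ) ^ (max B' 0)) ^ 2 * (N : ℝ) ^ A) := by ring
    _ = K * max M 0 ^ 2 * (N : ℝ) ^ (2 * max B' 0 + A) := by rw [hexp]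

/-- (F3') The same with the tree's hypothesis shapes (`abcLe_iff_freyDegreeConjecture_of`,
`freyDegreeBound_rpow_of_abcLe_of_petersson_of_manin`): a Petersson upper bound
`(f,f) ≤ C₂ N^{1+θ}` and Frey data with ABSOLUTELY bounded Manin constant `|c_D| ≤ M`.
[cite: MurtyCongruencePrimes1999, Thm. 1 (ii) and §2] -/
theorem polyFreyDegree_of_bakerShapeBound_of_petersson_of_manin' {θ : ℝ}
    (hUp : ∃ C₂ : ℝ, ∀ (N : ℕ) [NeZero N] (W : WeierstrassCurve ℚ) [W.IsElliptic]
      (f : CuspForm (Gamma0 N) 2), IsNewformOf W f →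
        (peterssonProduct (Gamma0 N) 2 f f).re ≤ C₂ * (N : ℝ) ^ (1 + θ))
    (hM : ∃ M : ℕ, ∀ a b : ℤ, IsCoprime a b → a * b * (a + b) ≠ 0 →
      ∀ (N : ℕ) [NeZero N], (freyCurve a b).conductorNorm ℤ = N →
        ∃ D : ModularParametrizationData (freyCurve a b) N, D.maninConstant.natAbs ≤ M)
    (hBS : BakerShapeBound 0 1) : PolyFreyDegree := by
  obtain ⟨C₂, hC₂⟩ := hUp
  obtain ⟨M, hMc⟩ := hM
  refine polyFreyDegree_of_bakerShapeBound_of_petersson_of_manin ⟨1 + θ, C₂, hC₂⟩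
    ⟨0, M, fun a b hab h0 N _ hN ↦ ?_⟩ hBS
  obtain ⟨D, hD⟩ := hMc a b hab h0 N hN
  refine ⟨D, ?_⟩
  rw [Real.rpow_zero, mul_one]
  exact_mod_cast hD

/-! ## (F4) The item is polynomial abc, modulo Murty's inputs -/

/-- **(F4) `PolyFreyDegree ↔ BakerShapeBound 0 1` relative to a polynomial Petersson upper bound
and Frey data with polynomially bounded Manin constant** — the `∃ κ`-shadow, one rung down, of
Murty's Theorem 1 (`abcLe_iff_freyDegreeConjecture_of`: abc ⟺ Frey's degree conjecture on Frey
curves). `→` is unconditional (F1); `←` is (F3). So the support item `PolyFreyDegree`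
(stmt-ABC-2026) is exactly polynomial abc given two true-in-print facts, beyond
`Literature.Barriers.ABC.BakerMethodBounds` (`BakerShapeBound (1/3) 3`, Stewart–Yu 2001).
[cite: MurtyCongruencePrimes1999, Thm. 1] -/
theorem polyFreyDegree_iff_bakerShapeBound_zero_one_of
    (hUp : ∃ B C₂ : ℝ, ∀ (N : ℕ) [NeZero N] (W : WeierstrassCurve ℚ) [W.IsElliptic]
      (f : CuspForm (Gamma0 N) 2), IsNewformOf W f →
        (peterssonProduct (Gamma0 N) 2 f f).re ≤ C₂ * (N : ℝ) ^ B)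
    (hM : ∃ B' M : ℝ, ∀ a b : ℤ, IsCoprime a b → a * b * (a + b) ≠ 0 →
      ∀ (N : ℕ) [NeZero N], (freyCurve a b).conductorNorm ℤ = N →
        ∃ D : ModularParametrizationData (freyCurve a b) N,
          (D.maninConstant.natAbs : ℝ) ≤ M * (N : ℝ) ^ B') :
    PolyFreyDegree ↔ BakerShapeBound 0 1 :=
  ⟨bakerShapeBound_zero_one_of_polyFreyDegree,
    polyFreyDegree_of_bakerShapeBound_of_petersson_of_manin hUp hM⟩

end Summit.ABC.ABC.Theorems.DefiniteXiPolyFreyDegree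

end
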